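import Literature.MathematicalPhysics.QuantumLattice.HubbardTTPrimeCheckerboardSublatticeFloor
import HarnessLib

/-!
# The kinematic hopping rows `|K₁|, |K₂|, |K₃| ≤ 16/π²` for EVERY translation-invariant state (all
# fillings `0 ≤ ρ ≤ 2`), and the `(16/π²)`-Lipschitz continuity in `t''` of the UNCONSTRAINED
# translation-invariant ground-state energy density of the `t–t'–t''` model

Topic `Literature/MathematicalPhysics/QuantumLattice` (family `hubbard`). The class-wide rows of
`HubbardTTPrimeAnchorWordBoxTransport` (`K₁`), `HubbardTTPrimeDiagHopTransportMinimiser` (`K₂`) and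
`InfVolFermionStateLatticeMapPullback` (`K₃`, via the doubling pullback) are stated for fillings
`0 < ρ < 2` (the variational inequality against `energyDensityTT'` needs it). At the two extreme fillings
every hopping expectation vanishes (`HubbardEnergyDensityChemicalPotential`:
`IsTranslationInvariant.hubbardEnergyDensity_eq_zero_of_density_eq_zero`, `…_eq_of_density_eq_two`), so the
rows hold for EVERY translation-invariant state — the form needed by consumers working with the
UNCONSTRAINED variational density `tiGroundEnergyDensity` (all translation-invariant states, all fillings;
cell `pub/hubbard-downfold`, the `t''`-allowance of the S1/S2 seam `holdsOn_inflate_of_lipschitz`):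

* `hubbardTTPrimeFermionInteraction_tPrime_zero` — `Φ(t, 0, U)` IS the nearest-neighbour Hubbard
  interaction `hubbardFermionInteraction 2 t U` (the `t' = 0` diagonal terms vanish).
* `IsTranslationInvariant.abs_meanEnergy_nnHop_le_of_any_density` — `|K₁(σ)| ≤ 16/π²` for every
  translation-invariant `σ`; `…_diagHop_…` — `|K₂(σ)| ≤ 16/π²` (`K₂(σ) = K₁(σ ∘ Γ_cb)`, checkerboard
  pullback); `…_axialRange2Hopping_…` — `|K₃(σ)| ≤ 16/π²` (`K₃(σ) = K₁(σ ∘ Γ_{2·})`, doubling pullback).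
* `abs_tiGroundEnergyDensity_tpp_sub_le_kinematic` — `|e₀(t,t',t'',U) − e₀(t,t',s'',U)| ≤ (16/π²)|t'' − s''|`
  for the UNCONSTRAINED density at range parameter `2` (`e₀ = tiGroundEnergyDensity`), improving the
  operator-norm constants `8` (`HubbardTTPrimeTPPInteraction`) / `4` (`HubbardHoppingBondNormSharp`).

Everything is PROVED; no definition, no named fact, no number, no `sorry`. HONEST SCOPE: kinematic
one-body constant; nothing bears on order / pairing words.

## References
* E. H. Lieb, M. Loss, Duke Math. J. 71 (1993) 337, §8 Thm. 8.2 (bathtub). [cite: LiebLoss1993, §8, Theorem 8.2]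
* R. B. Israel, *Convexity in the Theory of Lattice Gases* (1979), Thm. I.3.4. [cite: Israel1979, Thm. I.3.4]
* O. Bratteli, D. W. Robinson, *OAQSM 1* (1987), Lemma 2.3.10 (Cauchy–Schwarz for states).
  [cite: BratteliRobinsonI1987, Lemma 2.3.10]
-/

noncomputable section

namespace Literature.MathematicalPhysics.QuantumLattice

open Matrix Finset HubbardWave0 Literature.Probability.LatticeModels ThermodynamicLimit
open scoped ComplexOrder BigOperators

/-- **`Φ(t, 0, U)` is the nearest-neighbour Hubbard interaction** (the diagonal terms with amplitude `0`
vanish). [cite: XuEtAl2024, eq. (1)] -/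
theorem hubbardTTPrimeFermionInteraction_tPrime_zero (t U : ℝ) :
    hubbardTTPrimeFermionInteraction t 0 U = hubbardFermionInteraction 2 t U := by
  refine FermionInteraction.ext fun X => ?_
  have h := diagHoppingFermionInteraction_smul 0 1 X
  rw [zero_mul, Complex.ofReal_zero, zero_smul] at h
  rw [hubbardTTPrimeFermionInteraction_apply, h, add_zero]

namespace InfVolFermionState

variable {ω : InfVolFermionState 2}

/-- **`|K₁(σ)| ≤ 16/π²` for EVERY translation-invariant state** (all fillings: at `ρ = 0` and `ρ = 2` the
hopping energy vanishes, in between the filling-class row applies). [cite: LiebLoss1993, §8, Theorem 8.2] -/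
theorem IsTranslationInvariant.abs_meanEnergy_nnHop_le_of_any_density (hω : ω.IsTranslationInvariant) :
    |ω.meanEnergy (hubbardTTPrimeFermionInteraction 1 0 0) 1| ≤ 16 / Real.pi ^ 2 := by
  have hpos : (0 : ℝ) ≤ 16 / Real.pi ^ 2 := by positivity
  rcases (ω.density_nonneg).eq_or_lt with h0 | h0
  · rw [hubbardTTPrimeFermionInteraction_tPrime_zero,
      show ω.meanEnergy (hubbardFermionInteraction 2 1 0) 1 = ω.hubbardEnergyDensity 1 0 from rfl,
      hω.hubbardEnergyDensity_eq_zero_of_density_eq_zero 1 0 h0.symm, abs_zero]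
    exact hpos
  rcases (ω.density_le_two).eq_or_lt with h2 | h2
  · rw [hubbardTTPrimeFermionInteraction_tPrime_zero,
      show ω.meanEnergy (hubbardFermionInteraction 2 1 0) 1 = ω.hubbardEnergyDensity 1 0 from rfl,
      hω.hubbardEnergyDensity_eq_of_density_eq_two 1 0 h2, abs_zero]
    exact hpos
  exact hω.abs_meanEnergy_nnHop_le h0 h2

/-- **`|K₂(σ)| ≤ 16/π²` for EVERY translation-invariant state**: `K₂(σ) = K₁(σ ∘ Γ_cb)` (checkerboard
pullback, `meanEnergy_mapAct_checkerboard`) and `σ ∘ Γ_cb` is translation invariant.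
[cite: LiebLoss1993, §8, Theorem 8.2] -/
theorem IsTranslationInvariant.abs_meanEnergy_diagHop_le_of_any_density (hω : ω.IsTranslationInvariant) :
    |ω.meanEnergy (hubbardTTPrimeFermionInteraction 0 1 0) 1| ≤ 16 / Real.pi ^ 2 := by
  rw [← ω.meanEnergy_mapAct_checkerboard 1 0]
  exact (hω.mapAct checkerboard checkerboard_injective).abs_meanEnergy_nnHop_le_of_any_density

/-- **`|K₃(σ)| ≤ 16/π²` for EVERY translation-invariant state**: `K₃(σ) = K₁(σ ∘ Γ_{2·})` (doubling
pullback, `meanEnergy_nnHop_mapAct_doubling`). [cite: LiebLoss1993, §8, Theorem 8.2] -/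
theorem IsTranslationInvariant.abs_meanEnergy_axialRange2Hopping_le_of_any_density
    (hω : ω.IsTranslationInvariant) :
    |ω.meanEnergy (axialRange2HoppingFermionInteraction 2 1) 2| ≤ 16 / Real.pi ^ 2 := by
  rw [← ω.meanEnergy_nnHop_mapAct_doubling]
  exact (hω.mapAct (doubling 2) doubling_injective).abs_meanEnergy_nnHop_le_of_any_density

end InfVolFermionState

/-- **The UNCONSTRAINED translation-invariant ground-state energy density of the `t–t'–t''` model is
`(16/π²)`-Lipschitz in `t''`** (range parameter `2`):
`|e₀(t,t',t'',U) − e₀(t,t',s'',U)| ≤ (16/π²)|t'' − s''|` — the class-constant Lipschitz bound along the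
pencil `Φ(t,t',U) + t''·Φ''(1)` with the all-fillings `K₃` row. [cite: Israel1979, Thm. I.3.4] -/
theorem abs_tiGroundEnergyDensity_tpp_sub_le_kinematic (t t' U t'' s'' : ℝ) :
    |(hubbardTT'T''FermionInteraction t t' t'' U).tiGroundEnergyDensity 2 -
        (hubbardTT'T''FermionInteraction t t' s'' U).tiGroundEnergyDensity 2| ≤
      16 / Real.pi ^ 2 * |t'' - s''| :=
  FermionInteraction.abs_infMeanEnergyOn_pencil_sub_le _ _ 2
    (S := {σ : InfVolFermionState 2 | σ.IsTranslationInvariant})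
    ⟨_, InfVolFermionState.vacuumState_isTranslationInvariant (d := 2)⟩
    (fun _ hσ => InfVolFermionState.IsTranslationInvariant.abs_meanEnergy_axialRange2Hopping_le_of_any_density hσ)
    t'' s''

/-- **Window transport for the unconstrained density**: `lo ≤ e₀(t,t',s'',U) ≤ hi` ⇒
`lo − (16/π²)|t'' − s''| ≤ e₀(t,t',t'',U) ≤ hi + (16/π²)|t'' − s''|`. [cite: Israel1979, Thm. I.3.4] -/
theorem tiGroundEnergyDensity_tpp_mem_Icc_of_window (t t' U : ℝ) {s'' lo hi : ℝ}
    (hlo : lo ≤ (hubbardTT'T''FermionInteraction t t' s'' U).tiGroundEnergyDensity 2)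
    (hhi : (hubbardTT'T''FermionInteraction t t' s'' U).tiGroundEnergyDensity 2 ≤ hi) (t'' : ℝ) :
    (hubbardTT'T''FermionInteraction t t' t'' U).tiGroundEnergyDensity 2 ∈
      Set.Icc (lo - 16 / Real.pi ^ 2 * |t'' - s''|) (hi + 16 / Real.pi ^ 2 * |t'' - s''|) := by
  have h := abs_sub_le_iff.1 (abs_tiGroundEnergyDensity_tpp_sub_le_kinematic t t' U t'' s'')
  constructor <;> linarith [h.1, h.2]

end Literature.MathematicalPhysics.QuantumLattice

end
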